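import Literature.MathematicalPhysics.QuantumLattice.GrassmannTruncatedSpectators
import Literature.MathematicalPhysics.QuantumLattice.GrassmannTreeExpansion
import HarnessLib

/-!
# The tree expansion with the lower-scale fields as spectators (BGM 2006, (2.66))

Topic `Literature/MathematicalPhysics/QuantumLattice`; joins `GrassmannTreeExpansion.lean` (the
Brydges–Battle–Federbush / Gawȩdzki–Kupiainen–Lesniewski formula for the truncated expectations of
balanced cluster monomials of a Gaussian Grassmann integration, all fields integrated) with
`GrassmannTruncatedSpectators.lean` (even-part-valued truncated expectations of a fermion *block*,
the remaining fields being spectators).  In Benfatto–Giuliani–Mastropietro 2006, (2.66),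
`𝓔ᵀ_h(ψ̃^{(h)}(P₁), …, ψ̃^{(h)}(P_s)) = Σ_T ∏_{ℓ∈T} g_ℓ ∫dP_T(t) det G^{h,T}(t)`, the monomials
`ψ̃(P_v)` are products of fields of scale `h` (integrated) and of the external fields `ψ^{(<h)}(P_v)`
(spectators); by `evenTruncated_spectator_mul` the external parts pull out, and the present file
identifies what is left — the truncated expectation, *inside the big algebra*, of the block-supported
balanced cluster monomials — with the scalar tree sum:

`𝓔ᵀ_block(e_* ψ̃(P_x) : x ∈ W) = (treeSum c G v W) · 1`   (`evenTruncated_evenCluster_eq_treeSum`),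

`G f f' = (A⁻¹)_{j f, i f'}`; and `gaussOn_refl_eq_gaussExp` — the one-block Gaussian integration
`gaussExp` of `GrassmannTreeExpansion.lean` is `gaussOn` for the identity embedding.  Everything is
proved; no named fact.

## Sources

G. Benfatto, A. Giuliani, V. Mastropietro, Ann. Henri Poincaré 7 (2006), (2.66)
(`BenfattoGiulianiMastropietro2006`); V. Mastropietro, *Non-Perturbative Renormalization* (2008),
(2.101), (2.118) (`Mastropietro2008`).
-/

noncomputable section

open Finset Matrix
open Literature.Probability.LatticeModels Literature.Probability.LatticeModels.BattleFederbush

namespace Literature.MathematicalPhysics.QuantumLattice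

open GrassmannAlgebra

/-- Coercion of a finite product in the even part is the (order-independent) product in the
algebra. [folklore] -/
theorem GrassmannAlgebra.coe_prod_eq_noncommProd {R : Type*} [CommRing R] {J : Type*} {α : Type*} [DecidableEq α]
    (a : α → evenPart R J) (P : Finset α) :
    ((∏ i ∈ P, a i : evenPart R J) : GrassmannAlgebra R J) =
      P.noncommProd (fun i => (a i : GrassmannAlgebra R J))
        fun i _ _ _ _ => commute_of_mem_evenOdd_zero R (a i).2 _ := by
  induction P using Finset.induction_on with
  | empty => rw [prod_empty, noncommProd_empty, OneMemClass.coe_one]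
  | insert i P hi ih =>
    rw [prod_insert hi, MulMemClass.coe_mul, noncommProd_insert_of_notMem _ _ _ _ hi, ih]

namespace FermionicTree

variable (R : Type*) [CommRing R] {n : Type*} [LinearOrder n]
variable {ι : Type*} [DecidableEq ι] {F : Type*} [Fintype F] [LinearOrder F]

omit [LinearOrder F] in
/-- Cluster monomials are even. [folklore] -/
theorem clusterMonomial_mem_evenOdd_zero (c : F → ι) (i j : F → n) (x : ι) :
    clusterMonomial R c i j x ∈ evenOdd R (ι := n ⊕ₗ n) 0 :=
  Finset.noncommProd_induction _ _ _ (· ∈ evenOdd R (ι := n ⊕ₗ n) 0)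
    (fun _ _ ha hb => mul_mem_evenOdd_zero R ha hb) (one_mem_evenOdd_zero R)
    fun _ _ => psiBar_mul_psi_mem_evenOdd_zero R _ _

/-- The cluster monomial `ψ̃(P_x) = ∏_{f : c f = x} ψ̄_{i f} ψ_{j f}` as an element of the even part
of the block algebra. [folklore] -/
def evenCluster (c : F → ι) (i j : F → n) (x : ι) : evenPart R (n ⊕ₗ n) :=
  ⟨clusterMonomial R c i j x, clusterMonomial_mem_evenOdd_zero R c i j x⟩

omit [LinearOrder F] in
/-- Unfolding `evenCluster`. [folklore] -/
@[simp] theorem coe_evenCluster (c : F → ι) (i j : F → n) (x : ι) :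
    (evenCluster R c i j x : GrassmannAlgebra R (n ⊕ₗ n)) = clusterMonomial R c i j x := rfl

variable [Fintype n] [Algebra ℚ R] {J : Type*} [LinearOrder J] [Fintype J]

/-- **The tree expansion with spectators** (Benfatto–Giuliani–Mastropietro 2006, (2.66), the
internal part): for a fermion block `e : n ⊕ₗ n ↪o J` with normalised Gaussian integration
(`u ε det A = 1`) and balanced cluster monomials `ψ̃(P_x)`, `x ∈ W`, supported in the block, the
even-part-valued truncated expectation in the big algebra is the scalar tree sum,
`𝓔ᵀ(e_* ψ̃(P_x) : x ∈ W) = (treeSum c G v W) · 1` with `G f f' = (A⁻¹)_{j f, i f'}`, for every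
root `v ∈ W`; the external (spectator) parts of the monomials are then restored by
`evenTruncated_spectator_mul`. [cite: BenfattoGiulianiMastropietro2006, (2.66)] -/
theorem evenTruncated_evenCluster_eq_treeSum [Fintype ι] (e : n ⊕ₗ n ↪o J) (A : Matrix n n R) (hA : IsUnit A.det)
    (u : R) (hu : u * ((-1 : R) ^ (Fintype.card n * (Fintype.card n - 1) / 2) * A.det) = 1)
    (c : F → ι) (i j : F → n) (W : Finset ι) {v : ι} (hv : v ∈ W) :
    evenTruncated R e A u (fun x => evenMap R e (evenCluster R c i j x)) W =
      algebraMap R (evenPart R J) (treeSum c (Matrix.of fun f f' => A⁻¹ (j f) (i f')) v W) := by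
  rw [evenTruncated_evenMap R e A u _ ⟨v, hv⟩, ← truncatedOf_gaussExp_clusterMonomial_eq_treeSum R A hA u hu c i j W hv,
    truncatedOf]
  congr 2
  funext Q
  rw [LinearMap.smul_apply, map_smul, smul_eq_mul, scalarPart_gaussExp, GrassmannAlgebra.coe_prod_eq_noncommProd]
  rfl

end FermionicTree

/-! ### The whole algebra as one block: `gaussExp = gaussOn (refl)` -/

section ReflBridge

variable (R : Type*) [CommRing R] {n : Type*} [LinearOrder n]

/-- Extension by zero along the identity is the identity. [folklore] -/
theorem extendByZero_linearMap_refl :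
    Function.ExtendByZero.linearMap R ((OrderIso.refl (n ⊕ₗ n)).toOrderEmbedding) = LinearMap.id := by
  refine LinearMap.ext fun f => funext fun a => ?_
  rw [Function.ExtendByZero.linearMap_apply, LinearMap.id_apply]
  exact Function.injective_id.extend_apply f 0 a

variable [Algebra ℚ R] [Fintype n]

/-- **`gaussExp` is `gaussOn` for the whole algebra as one block** (the identity embedding; the
bridge between `GrassmannTreeExpansion.lean` and `GrassmannGaussianExpectation.lean` asked for in
the review of the former). [folklore] -/
theorem FermionicTree.gaussOn_refl_eq_gaussExp (A : Matrix n n R) (y : GrassmannAlgebra R (n ⊕ₗ n)) :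
    gaussOn R (OrderIso.refl (n ⊕ₗ n)).toOrderEmbedding A y = FermionicTree.gaussExp R A y := by
  have h := gaussOn_map R (OrderIso.refl (n ⊕ₗ n)).toOrderEmbedding A y
  rw [extendByZero_linearMap_refl, ExteriorAlgebra.map_id] at h
  exact h

end ReflBridge

end Literature.MathematicalPhysics.QuantumLattice
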